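import Summits.HodgeConjecture.HodgeConjecture.Theorems.H413CohFormsCarriers
import Summits.HodgeConjecture.HodgeConjecture.Theorems.H413CuspCotComponents
import Summits.HodgeConjecture.HodgeCM.Model.AdelicThetaDistributionSat_1
import HarnessLib

/-!
# FLOOR-0 P4, stub T2′ (hol half) — TRANSPORT of the P0 carrier `holCotForms (archFactorOf F V)` to the regime model:
# `f ↦ f ∘ e⁻¹` lands in `cuspCotSat V hV K` for every open level `K` fixing `f`, with the same components

Cell hodgecm-mathlib (D-0151), FLOOR 0, crux item H413 = stmt-HodgeConjecture-24833; programme P4, line `Cruxes/H413/Lines/P4AdmissibleOccursInH1.lean`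
v2.1, stub `stub_T2_matsushimaHodgeAt`.  Author A-p13 (g21).  `--supports stmt-HodgeConjecture-24833 --as helper`.

`e := latticeEquiv F V hV : U(V)(𝔸_{F⁺}) ≃* G_U(𝔸)` is the tree's identification of the P0 currency `(adelicDatum F V).Adelic =
(UnitaryGroup.adelicGroupData F⁺ K c̄ 3 (Hm V)).Adelic` with the HodgeCM regime model group `(V.latticeModel _).G` (J0(d) twin ∘ `regimeEquiv`,
anisotropic regime `hV`); pointwise it IS `HodgeCM.Model.toLatticeModelG V` (`latticeEquiv_apply`, ★ `toLatticeModelG_eq_regimeEquiv_twin`), so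
`e ∘ (archFactorOf F V).ιinf = archInfOf V` and `e ∘ finToAdelic = finToG V hV` (P0 §3).  Results:
* `toRegimeFun F V hV : (U(V)(𝔸_{F⁺}) → ℂ²) →ₗ[ℂ] (G_U(𝔸) → ℂ²)`, `f ↦ f ∘ e.symm`; injective; `comp V hV (toRegimeFun f) h = (x ↦ f (ιinf x · (1,h)))`
  (`comp_toRegimeFun`); intertwines `rightRep F V g` with `rightShift (finToG V hV g)` (`toRegimeFun_rightRep`);
* **`toRegimeFun_mem_cuspCotSat`**: for `f ∈ holCotForms (archFactorOf F V)` fixed by `rightRep k`, `k ∈ K`: `toRegimeFun f ∈ cuspCotSat V hV K` —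
  (L) rational points correspond (`mem_adelicUnitaryRat_iff`, `regimeEquiv_mem_regimeRat_iff`); (W) the weight clause is transported along
  `e ∘ ιinf = archInfOf V`; (R) an element of `sat(K)` is `e` of `a·(1,k)` with `a` archimedean of trivial `ι₁`-component (∈ `(archFactorOf F V).Kc`)
  and `k ∈ K` (`mem_satLevelOf_iff`, `mem_awayFrom_iff`, `archToAdelic_mul_finAdelicToAdelic`); (H) germs correspond.
With `Theorems/H413CuspCotTower.lean` this gives, for every such `f`, the class `clsAt Γ ⟨toRegimeFun f, _⟩` in the HodgeCM tower at the level
`Γ = Level.capThree K _`; what is then left of T2′'s hol half is bookkeeping (one map on the union over `K`, `clsAt_of_le`) and `rhoB = act`.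
HC_CM is proved only modulo the 7 printed citations until rung 0 closes; this file proves nothing about them.
[cite: BorelJacquet1979, §4.1–§4.2] [cite: PlatonovRapinchuk1994, §5.1] [cite: BorelWallach2000, XIII 1.2]

## References
* [BorelJacquet1979] A. Borel, H. Jacquet, Corvallis PSPM 33.1, §4.1–§4.2.  * [PlatonovRapinchuk1994] §5.1.  * [BorelWallach2000] XIII 1.2.
* Tree: P0 `Theorems/H413CohFormsCarriers` (§3 `archFactorOf`, `toLatticeModelG_archFactorOf_ιinf`, `toLatticeModelG_finToAdelic`),
  `Theorems/H413CuspCotComponents` (`cuspCotSat`, `comp`), HodgeCM `Model/ArchKTypeOf` (`toLatticeModelG_eq_regimeEquiv_twin`),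
  `Model/Junction/LevelSaturation` (`satLevelRegimeOf`, `mem_satLevelOf_iff`), ★ `Automorphic/UnitaryGroupArchSection`, `UnitaryGroupAdelicProduct`.
-/

set_option autoImplicit false
set_option linter.dupNamespace false

noncomputable section

open MulAction NumberField
open Literature.NumberTheory.Automorphic Literature.NumberTheory.Automorphic.UnitaryGroup
open Literature.Geometry.ComplexHyperbolic.BallModel (U21 x₀)
open Literature.AlgebraicGeometry.ShimuraVarieties
open HodgeCM HodgeCM.Model HodgeCM.Model.ThetaSpace
open Summit.HodgeConjecture.HodgeConjecture.Cruxes.H413.CohFormsCarriers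

namespace Summit.HodgeConjecture.HodgeConjecture.Cruxes.H413.CuspCot

variable (F : HodgeCM.CMField) {ι₁ : F →+* ℂ} (V : HodgeCM.HermSpace3 F ι₁) (hV : IsAnisotropic F (HodgeCM.HermSpace3.Hm V))

/-! ## §1 The identification `e : U(V)(𝔸_{F⁺}) ≃* G_U(𝔸)` and the transport of functions -/

/-- **`e : U(V)(𝔸_{F⁺}) ≃* G_U(𝔸)`** — J0(d) twin followed by `regimeEquiv` (anisotropic regime). [cite: BorelJacquet1979, §4.1] -/
def latticeEquiv : (adelicDatum F V).Adelic ≃* (V.latticeModel printFact_unitaryCompact_holds).G :=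
  (Junction.adelicUnitaryGroupTwin (HodgeCM.CMField.K F) (HodgeCM.HermSpace3.Hm V)).toMulEquiv.trans
    (HodgeCM.Adelic.regimeEquiv F (HodgeCM.HermSpace3.Hm V) hV).toMulEquiv

/-- `e` IS `toLatticeModelG V` pointwise (★ `toLatticeModelG_eq_regimeEquiv_twin`). [cite: BorelJacquet1979, §4.1] -/
theorem latticeEquiv_apply (x : (adelicDatum F V).Adelic) : latticeEquiv F V hV x = toLatticeModelG V x := by
  rw [toLatticeModelG_apply, HodgeCM.Adelic.toRegime_apply_of _ _ hV]
  rfl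

/-- `e ∘ ιinf = archInfOf V` for the factor of record. [cite: BorelJacquet1979, §4.1] -/
theorem latticeEquiv_ιinf (u : ↥U21) : latticeEquiv F V hV ((archFactorOf F V).ιinf u) = archInfOf V u := by
  rw [latticeEquiv_apply]; exact toLatticeModelG_archFactorOf_ιinf F V u

/-- `e (1, g) = finToG V hV g`. [cite: BorelJacquet1979, §4.1] -/
theorem latticeEquiv_finToAdelic (g : ↥(HodgeCM.HermSpace3.adelicFin V)) :
    latticeEquiv F V hV (finToAdelic F V g) = finToG V hV g := by
  rw [latticeEquiv_apply]; exact toLatticeModelG_finToAdelic F V hV g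

/-- `e.symm (archInfOf V u) = ιinf u`. [cite: BorelJacquet1979, §4.1] -/
theorem latticeEquiv_symm_archInfOf (u : ↥U21) : (latticeEquiv F V hV).symm (archInfOf V u) = (archFactorOf F V).ιinf u := by
  rw [MulEquiv.symm_apply_eq, latticeEquiv_ιinf]

/-- `e.symm (finToG V hV g) = (1, g)`. [cite: BorelJacquet1979, §4.1] -/
theorem latticeEquiv_symm_finToG (g : ↥(HodgeCM.HermSpace3.adelicFin V)) :
    (latticeEquiv F V hV).symm (finToG V hV g) = finToAdelic F V g := by
  rw [MulEquiv.symm_apply_eq, latticeEquiv_finToAdelic]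

/-- **Transport of functions** `f ↦ f ∘ e⁻¹`, a `ℂ`-linear map. [cite: BorelJacquet1979, §4.2] -/
def toRegimeFun : ((adelicDatum F V).Adelic → (Fin 2 → ℂ)) →ₗ[ℂ] ((V.latticeModel printFact_unitaryCompact_holds).G → (Fin 2 → ℂ)) :=
  LinearMap.funLeft ℂ (Fin 2 → ℂ) (latticeEquiv F V hV).symm

/-- Unfolding `toRegimeFun`. [cite: BorelJacquet1979, §4.2] -/
@[simp] theorem toRegimeFun_apply (f : (adelicDatum F V).Adelic → (Fin 2 → ℂ)) (y : (V.latticeModel printFact_unitaryCompact_holds).G) :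
    toRegimeFun F V hV f y = f ((latticeEquiv F V hV).symm y) := rfl

/-- `toRegimeFun` is injective (`e` is a bijection). [cite: BorelJacquet1979, §4.2] -/
theorem toRegimeFun_injective : Function.Injective (toRegimeFun F V hV) :=
  LinearMap.funLeft_injective_of_surjective _ _ _ (latticeEquiv F V hV).symm.surjective

/-- **The components of the transported function are the components of `f`**: `comp (f ∘ e⁻¹) h = (x ↦ f (ιinf x · (1,h)))`.
[cite: BorelWallach2000, XIII 1.2] -/
theorem comp_toRegimeFun (f : (adelicDatum F V).Adelic → (Fin 2 → ℂ)) (h : ↥(HodgeCM.HermSpace3.adelicFin V)) :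
    comp V hV (toRegimeFun F V hV f) h = fun x => f ((archFactorOf F V).ιinf x * finToAdelic F V h) := by
  funext x
  rw [comp_apply, toRegimeFun_apply, map_mul, latticeEquiv_symm_archInfOf, latticeEquiv_symm_finToG]

/-- **`toRegimeFun` intertwines the finite-adelic right translations**: `(R_g f) ∘ e⁻¹ = R_{e_g} (f ∘ e⁻¹)`. [cite: BorelJacquet1979, §4.2] -/
theorem toRegimeFun_rightRep (g : ↥(HodgeCM.HermSpace3.adelicFin V)) (f : (adelicDatum F V).Adelic → (Fin 2 → ℂ)) :
    toRegimeFun F V hV (rightRep F V g f) = rightShift (finToG V hV g) (toRegimeFun F V hV f) := by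
  funext y
  rw [rightShift_apply, toRegimeFun_apply, toRegimeFun_apply, map_mul, latticeEquiv_symm_finToG]
  rfl

/-! ## §2 The transported form is a saturated cuspidal cotangent form of every level fixing it -/

/-- Rational points correspond: `γ ∈ G_U(L⁺)` of the regime model ⇒ `e⁻¹ γ` is the image of a rational point of `U(V)`.
[cite: BorelJacquet1979, §4.1] -/
theorem latticeEquiv_symm_mem_range_toAdelic {γ : (V.latticeModel printFact_unitaryCompact_holds).G}
    (hγ : γ ∈ (V.latticeModel printFact_unitaryCompact_holds).Γ) :
    (latticeEquiv F V hV).symm γ ∈ (adelicDatum F V).toAdelic.range := by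
  -- `γ` read in `U(V)(𝔸)` is a rational point (`mem_regimeRat_iff`), i.e. the diagonal image of some `g ∈ U(V)(L⁺)`
  have h1 := (HodgeCM.Adelic.mem_regimeRat_iff (L := F) (H := HodgeCM.HermSpace3.Hm V) γ).1 hγ
  obtain ⟨g, hg, hge⟩ := (Literature.NumberTheory.Automorphic.mem_adelicUnitaryRat_iff (HodgeCM.CMField.K F) (HodgeCM.HermSpace3.Hm V) _).1
    ((Junction.adelicUnitaryGroupTwin_mem_rat_iff (HodgeCM.CMField.K F) (HodgeCM.HermSpace3.Hm V) _).1 h1)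
  refine ⟨⟨g, hg⟩, Subtype.ext ?_⟩
  -- both sides are the diagonal matrix of `g` in `GL₃(𝔸_L)`
  exact hge

/-- An element of the saturation subgroup `sat(K)` is `e (a · (1,k))` with `a` archimedean of trivial `ι₁`-component and `k ∈ K`.
[cite: BorelJacquet1979, §4.1] -/
theorem exists_of_mem_satLevelRegimeOf {K : Subgroup ↥(HodgeCM.HermSpace3.adelicFin V)}
    {a : (V.latticeModel printFact_unitaryCompact_holds).G} (ha : a ∈ satLevelRegimeOf V hV K) :
    ∃ (b : (adelicDatum F V).Adelic) (k : ↥(HodgeCM.HermSpace3.adelicFin V)), b ∈ (archFactorOf F V).Kc ∧ k ∈ K ∧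
      (latticeEquiv F V hV).symm a = b * finToAdelic F V k := by
  obtain ⟨g, hg, hga⟩ := Subgroup.mem_map.1 ha
  obtain ⟨hgaway, hgK⟩ := (mem_satLevelOf_iff V K g).1 hg
  -- `e⁻¹ a = g`
  have hsymm : (latticeEquiv F V hV).symm a = g := by
    rw [MulEquiv.symm_apply_eq, ← hga]; rfl
  -- decompose `g = (g_∞, 1) · (1, g_f)`; the archimedean part has trivial `ι₁`-component, the finite part lies in `K`
  refine ⟨archToAdelic' F V (archPart (↥(maximalRealSubfield (HodgeCM.CMField.K F))) (HodgeCM.CMField.K F)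
      (IsCMField.complexConj (HodgeCM.CMField.K F)) 3 (HodgeCM.HermSpace3.Hm V) g),
    finPart (↥(maximalRealSubfield (HodgeCM.CMField.K F))) (HodgeCM.CMField.K F) (IsCMField.complexConj (HodgeCM.CMField.K F)) 3
      (HodgeCM.HermSpace3.Hm V) g, ?_, ?_, ?_⟩
  · rw [archFactorOf_Kc]
    refine Subgroup.mem_map.2 ⟨_, ?_, rfl⟩
    have h1 : archPart (↥(maximalRealSubfield (HodgeCM.CMField.K F))) (HodgeCM.CMField.K F) (IsCMField.complexConj (HodgeCM.CMField.K F)) 3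
        (HodgeCM.HermSpace3.Hm V) g ∈ (archAt (↥(maximalRealSubfield (HodgeCM.CMField.K F))) (HodgeCM.CMField.K F)
          (IsCMField.complexConj (HodgeCM.CMField.K F)) 3 (HodgeCM.HermSpace3.Hm V) (cmPlace (HodgeCM.CMField.K F) ι₁)
          (UnitaryGroup.complexConj_smul_infinitePlace (HodgeCM.CMField.K F) _) (IsCMField.complexConj_ne_one (HodgeCM.CMField.K F))).ker :=
      MonoidHom.mem_ker.2 ((mem_awayFrom_iff _ _ _ 3 _ _ _ _ g).1 hgaway)
    rw [← ker_archProjU21Emb _ _ _ (HodgeCM.HermSpace3.Hm V) ι₁ (isComplex_mk_of_isCMField (HodgeCM.CMField.K F) ι₁) V.sylvesterFrame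
      (formCongr_eq_of_conjTranspose (HodgeCM.CMField.K F) ι₁ (HodgeCM.HermSpace3.Hm V) V.sylvesterFrame (HodgeCM.Model.sylvesterFrame_J V))] at h1
    exact h1
  · exact (mem_cmSplitLevel_iff _ _ _ _ g).1 hgK
  · rw [hsymm]
    exact (archToAdelic_mul_finAdelicToAdelic _ _ _ 3 _ g).symm

variable {F V hV}

/-- **TRANSPORT**: a holomorphic cotangent form for the factor of record, fixed by the open level `K`, is — read on the regime model — a
saturated cuspidal cotangent form of level `K`. [cite: BorelJacquet1979, §4.1–§4.2] [cite: BorelWallach2000, XIII 1.2] -/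
theorem toRegimeFun_mem_cuspCotSat {f : (adelicDatum F V).Adelic → (Fin 2 → ℂ)} (hf : f ∈ holCotForms (archFactorOf F V))
    {K : Subgroup ↥(HodgeCM.HermSpace3.adelicFin V)} (hK : ∀ k ∈ K, rightRep F V k f = f) :
    toRegimeFun F V hV f ∈ cuspCotSat V hV K := by
  obtain ⟨⟨⟨hW, hKc⟩, -⟩, hH⟩ := hf
  refine cuspCotSat.mem_of (fun γ hγ y => ?_) (fun u y => ?_) (fun a ha y => ?_) ?_
  · -- (L) left invariance under the rational points
    obtain ⟨g, hg⟩ := latticeEquiv_symm_mem_range_toAdelic F V hV hγ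
    rw [toRegimeFun_apply, toRegimeFun_apply, map_mul, ← hg]
    exact hW.1 _ ⟨g, rfl⟩ _
  · -- (W) weight along `archInfOf V ∘ κ₁`
    rw [toRegimeFun_apply, toRegimeFun_apply, map_mul, latticeEquiv_symm_archInfOf]
    exact hW.2 u _
  · -- (R) right invariance under `sat(K)`
    obtain ⟨b, k, hb, hk, hdec⟩ := exists_of_mem_satLevelRegimeOf F V hV ha
    rw [toRegimeFun_apply, toRegimeFun_apply, map_mul, hdec, ← mul_assoc]
    have h1 := congrFun (hK k hk) ((latticeEquiv F V hV).symm y * b)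
    change f ((latticeEquiv F V hV).symm y * b * finToAdelic F V k) = f ((latticeEquiv F V hV).symm y * b) at h1
    rw [h1]
    exact hKc b hb _
  · -- (H) holomorphic germs
    have e : ∀ y, germAt (archInfOf V) (toRegimeFun F V hV f) y = germAt (archFactorOf F V).ιinf f ((latticeEquiv F V hV).symm y) := by
      intro y; funext b
      rw [germAt_apply, germAt_apply, toRegimeFun_apply, map_mul, latticeEquiv_symm_archInfOf]
    exact ⟨fun y => by rw [e]; exact hH.1 _, fun y v => by rw [e]; exact hH.2 _ v⟩

/-- The same for a COHOMOLOGICAL cotangent form's holomorphic part is the typical use; recorded: every `f ∈ holCotForms 𝔞₀` is fixed by SOME open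
`K` (smoothness), hence is read at the PKG level `Level.capThree K _` below `K_f(3)`. [cite: BorelJacquet1979, §4.2] -/
theorem exists_level_toRegimeFun_mem_cuspCotSat {f : (adelicDatum F V).Adelic → (Fin 2 → ℂ)} (hf : f ∈ holCotForms (archFactorOf F V))
    {K : Subgroup ↥(HodgeCM.HermSpace3.adelicFin V)} (hKo : IsOpen (K : Set ↥(HodgeCM.HermSpace3.adelicFin V)))
    (hK : ∀ k ∈ K, rightRep F V k f = f) :
    ∃ Γ : Level V, Γ.BelowConjThree ∧ toRegimeFun F V hV f ∈ cuspCotSat V hV Γ.K :=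
  ⟨Level.capThree K hKo, Level.belowConjThree_capThree K hKo,
    cuspCotSat_anti (Level.capThree_K_le K hKo) (toRegimeFun_mem_cuspCotSat hf hK)⟩

end Summit.HodgeConjecture.HodgeConjecture.Cruxes.H413.CuspCot

end
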